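import Mathlib
import Summits.RiemannHypothesis.RiemannHypothesis.Theorems.WeilGroundStateGroundStatesConvergeToXiStubPsiDecay
import Summits.RiemannHypothesis.RiemannHypothesis.Theorems.WeilGroundStateGroundStatesConvergeToXiStubMellinXi
import Literature.NumberTheory.LFunctions.WeilExplicit
import Literature.NumberTheory.LFunctions.WeilGroundState
import Literature.NumberTheory.LFunctions.RiemannXi

/-!
# Stub `stub_moments_of_strip` of the line `Sketch`
(crux `WeilGroundState.GroundStatesConvergeToXi`, item stmt-RiemannHypothesis-1527)

**Locally uniform convergence on the strip forces convergence of all moments.**  For ground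
states `u_k` of Weil's truncated quadratic form (`IsWeilGroundState (a k) (u k)`) and scalars
`c_k`, if the renormalised Mellin–Laplace transforms `c_k · weilMellin u_k` converge to `riemannXi`
locally uniformly on the open critical strip `{0 < Re s < 1}`, then for every `n : ℕ`
`c_k ∫ u_k(t) tⁿ dt → ∫ Φ(t) tⁿ dt`, where `Φ(t) = 2Ψ(2t)` (`Ψ = LagariasMontague.Psic`) is
Riemann's kernel, whose transform is `ξ` (`stub_mellinXi`).

Proof.
1. *Exponential-moment class.* For an a.e.-strongly measurable `v : ℝ → ℂ` all of whose
   exponential moments `∫ ‖v(t)‖ e^{A|t|} dt` are finite, `v̂ = weilMellin v` is complex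
   differentiable everywhere with `v̂' = weilMellin (t ↦ v(t) t)` (differentiation under the
   integral sign, dominated on the ball `‖s − s₀‖ < 1` by `‖v(t)‖ |t| e^{(‖s₀‖+2)|t|}`, the pattern
   of `IsWeilGroundState.hasDerivAt_weilMellin`), and the class is stable under `v ↦ v · t`
   (`|t| ≤ e^{|t|}`).  By induction `iteratedDeriv n v̂ = weilMellin (t ↦ v(t) tⁿ)`, whose value
   at `s = 1/2` is the moment `∫ v(t) tⁿ dt`.
2. Both `c_k u_k` (integrable, a.e. zero off the compact window) and `Φ` (all exponential moments
   of `Ψ(2·)` are finite, `stub_psiDecay`) lie in the class; and `riemannXi = weilMellin Φ`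
   (`stub_mellinXi`).
3. *Weierstrass.* Entire functions converging locally uniformly on an open set have all iterated
   derivatives converging locally uniformly there (`TendstoLocallyUniformlyOn.deriv`, iterated);
   evaluate at `1/2 ∈ {0 < Re s < 1}`.
-/

set_option linter.dupNamespace false

noncomputable section

open MeasureTheory Complex Filter Set
open scoped Real Topology

namespace Summit.RiemannHypothesis.RiemannHypothesis.Theorems.GroundStatesConvergeToXi

open Literature.NumberTheory.LFunctions

/-! ## The exponential-moment class and the derivatives of `weilMellin` -/

section ExpMoments

variable {v : ℝ → ℂ}

/-- The exponential-moment class is stable under multiplication by `t`: if all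
`∫ ‖v(t)‖ e^{A|t|} dt` are finite then so are all `∫ ‖v(t) t‖ e^{A|t|} dt` (`|t| ≤ e^{|t|}`).
[folklore] -/
theorem momentsOfStrip_expMoment_mul_id (hv : AEStronglyMeasurable v volume)
    (hM : ∀ A : ℝ, Integrable (fun t : ℝ => ‖v t‖ * Real.exp (A * |t|))) (A : ℝ) :
    Integrable (fun t : ℝ => ‖v t * (t : ℂ)‖ * Real.exp (A * |t|)) := by
  have hm : AEStronglyMeasurable (fun t : ℝ => v t * (t : ℂ)) volume :=
    hv.mul continuous_ofReal.aestronglyMeasurable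
  refine (hM (A + 1)).mono'
    (hm.norm.mul (by fun_prop : Continuous fun t : ℝ => Real.exp (A * |t|)).aestronglyMeasurable)
    (ae_of_all _ fun t => ?_)
  rw [Real.norm_of_nonneg (by positivity), norm_mul, Complex.norm_real, Real.norm_eq_abs]
  have h1 : |t| ≤ Real.exp |t| := by linarith [Real.add_one_le_exp |t|]
  calc ‖v t‖ * |t| * Real.exp (A * |t|) ≤ ‖v t‖ * Real.exp |t| * Real.exp (A * |t|) := by gcongr
    _ = ‖v t‖ * Real.exp ((A + 1) * |t|) := by
        rw [mul_assoc, ← Real.exp_add]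
        congr 2
        ring

/-- In the exponential-moment class every Mellin integrand `v(t) e^{(s-1/2)t}` is integrable
(dominated by `‖v(t)‖ e^{|Re s − 1/2| |t|}`). [folklore] -/
theorem momentsOfStrip_integrable_mul_cexp (hv : AEStronglyMeasurable v volume)
    (hM : ∀ A : ℝ, Integrable (fun t : ℝ => ‖v t‖ * Real.exp (A * |t|))) (s : ℂ) :
    Integrable fun t : ℝ => v t * cexp ((s - 1 / 2) * t) := by
  refine (hM |s.re - 1 / 2|).mono'
    (hv.mul (by fun_prop : Continuous fun t : ℝ => cexp ((s - 1 / 2) * t)).aestronglyMeasurable)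
    (ae_of_all _ fun t => ?_)
  rw [norm_mul, Complex.norm_exp]
  have hre : ((s - 1 / 2) * (t : ℂ)).re = (s.re - 1 / 2) * t := by simp [sub_re, mul_re]
  rw [hre]
  refine mul_le_mul_of_nonneg_left (Real.exp_le_exp.2 ?_) (norm_nonneg _)
  rw [← abs_mul]
  exact le_abs_self _

/-- **Differentiation under the integral sign.** In the exponential-moment class,
`v̂ = weilMellin v` is complex differentiable at every `s₀` with derivative
`weilMellin (t ↦ v(t) t) s₀ = ∫ v(t) t e^{(s₀-1/2)t} dt` (dominated on the ball `‖s − s₀‖ < 1` by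
`‖v(t)‖ |t| e^{(‖s₀‖+2)|t|}`). [folklore] -/
theorem momentsOfStrip_hasDerivAt (hv : AEStronglyMeasurable v volume)
    (hM : ∀ A : ℝ, Integrable (fun t : ℝ => ‖v t‖ * Real.exp (A * |t|))) (s₀ : ℂ) :
    HasDerivAt (weilMellin v) (weilMellin (fun t : ℝ => v t * (t : ℂ)) s₀) s₀ := by
  -- adapted from `IsWeilGroundState.hasDerivAt_weilMellin`
  -- (Literature/NumberTheory/LFunctions/WeilGroundState.lean)
  set A : ℝ := ‖s₀‖ + 2 with hA
  have hF_meas : ∀ᶠ s in 𝓝 s₀,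
      AEStronglyMeasurable (fun t : ℝ => v t * cexp ((s - 1 / 2) * t)) volume :=
    Eventually.of_forall fun s =>
      hv.mul (by fun_prop : Continuous fun t : ℝ => cexp ((s - 1 / 2) * t)).aestronglyMeasurable
  have hF_int : Integrable (fun t : ℝ => v t * cexp ((s₀ - 1 / 2) * t)) :=
    momentsOfStrip_integrable_mul_cexp hv hM s₀
  have hF'_meas :
      AEStronglyMeasurable (fun t : ℝ => v t * (t * cexp ((s₀ - 1 / 2) * t))) volume :=
    hv.mul
      (by fun_prop : Continuous fun t : ℝ => (t : ℂ) * cexp ((s₀ - 1 / 2) * t)).aestronglyMeasurable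
  have h_bound : ∀ᵐ t : ℝ, ∀ s ∈ Metric.ball s₀ 1,
      ‖v t * (t * cexp ((s - 1 / 2) * t))‖ ≤ ‖v t‖ * (|t| * Real.exp (A * |t|)) := by
    refine Eventually.of_forall fun t s hs => ?_
    rw [norm_mul, norm_mul, Complex.norm_exp, Complex.norm_real, Real.norm_eq_abs]
    refine mul_le_mul_of_nonneg_left (mul_le_mul_of_nonneg_left (Real.exp_le_exp.2 ?_)
      (abs_nonneg _)) (norm_nonneg _)
    have hre : ((s - 1 / 2) * (t : ℂ)).re = (s.re - 1 / 2) * t := by simp [sub_re, mul_re]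
    rw [hre]
    have hs' : ‖s - s₀‖ < 1 := by rwa [Metric.mem_ball, dist_eq_norm] at hs
    have h3 : |s.re - 1 / 2| ≤ A := by
      have e : s.re - 1 / 2 = (s - s₀).re + s₀.re + (-(1 / 2)) := by simp; ring
      rw [e, hA]
      refine (abs_add_three _ _ _).trans ?_
      rw [abs_neg, abs_of_pos (by norm_num : (0 : ℝ) < 1 / 2)]
      linarith [abs_re_le_norm (s - s₀), abs_re_le_norm s₀]
    calc (s.re - 1 / 2) * t ≤ |(s.re - 1 / 2) * t| := le_abs_self _
      _ = |s.re - 1 / 2| * |t| := abs_mul _ _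
      _ ≤ A * |t| := mul_le_mul_of_nonneg_right h3 (abs_nonneg _)
  have bound_integrable : Integrable fun t : ℝ => ‖v t‖ * (|t| * Real.exp (A * |t|)) := by
    refine (momentsOfStrip_expMoment_mul_id hv hM A).congr (ae_of_all _ fun t => ?_)
    simp only [norm_mul, Complex.norm_real, Real.norm_eq_abs, mul_assoc]
  have h_diff : ∀ᵐ t : ℝ, ∀ s ∈ Metric.ball s₀ 1,
      HasDerivAt (fun s : ℂ => v t * cexp ((s - 1 / 2) * t))
        (v t * (t * cexp ((s - 1 / 2) * t))) s :=
    Eventually.of_forall fun t s _ => hasDerivAt_weilIntegrand v t s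
  have key := (hasDerivAt_integral_of_dominated_loc_of_deriv_le (Metric.ball_mem_nhds s₀ one_pos)
    hF_meas hF_int hF'_meas h_bound bound_integrable h_diff).2
  have e : weilMellin (fun t : ℝ => v t * (t : ℂ)) s₀ =
      ∫ t : ℝ, v t * (t * cexp ((s₀ - 1 / 2) * t)) := by
    simp only [weilMellin, mul_assoc]
  rw [e]
  exact key

/-- **Iterated derivatives of `weilMellin`.** In the exponential-moment class,
`iteratedDeriv n (weilMellin v) = weilMellin (t ↦ v(t) tⁿ)` for every `n` (induction on `n`,
differentiating under the integral sign and using the stability of the class under `v ↦ v · t`).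
[folklore] -/
theorem momentsOfStrip_iteratedDeriv (n : ℕ) {v : ℝ → ℂ} (hv : AEStronglyMeasurable v volume)
    (hM : ∀ A : ℝ, Integrable (fun t : ℝ => ‖v t‖ * Real.exp (A * |t|))) :
    iteratedDeriv n (weilMellin v) = weilMellin (fun t : ℝ => v t * (t : ℂ) ^ n) := by
  induction n generalizing v with
  | zero => simp [iteratedDeriv_zero]
  | succ n ih =>
    rw [iteratedDeriv_succ']
    have hd : deriv (weilMellin v) = weilMellin (fun t : ℝ => v t * (t : ℂ)) :=
      funext fun s => (momentsOfStrip_hasDerivAt hv hM s).deriv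
    have hv' : AEStronglyMeasurable (fun t : ℝ => v t * (t : ℂ)) volume :=
      hv.mul continuous_ofReal.aestronglyMeasurable
    have hM' : ∀ A : ℝ, Integrable (fun t : ℝ => ‖v t * (t : ℂ)‖ * Real.exp (A * |t|)) :=
      momentsOfStrip_expMoment_mul_id hv hM
    rw [hd, ih hv' hM']
    congr 1
    funext t
    ring

/-- At the centre `s = 1/2` the transform is the plain integral: `weilMellin w (1/2) = ∫ w`.
[folklore] -/
theorem momentsOfStrip_weilMellin_half (w : ℝ → ℂ) : weilMellin w (1 / 2) = ∫ t : ℝ, w t := by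
  simp [weilMellin]

end ExpMoments

/-! ## Weierstrass: iterated derivatives of locally uniform limits of entire functions -/

/-- **Weierstrass' theorem, iterated.** If entire functions `F i` converge to `f` locally
uniformly on an open set `U ⊆ ℂ` along a filter `p`, then for every `n` the `n`-th iterated
derivatives `iteratedDeriv n (F i)` converge to `iteratedDeriv n f` locally uniformly on `U`
(`TendstoLocallyUniformlyOn.deriv`, iterated; entire functions have entire derivatives).
[folklore] -/
theorem momentsOfStrip_tendstoLocallyUniformlyOn_iteratedDeriv {ι : Type*} {p : Filter ι}
    {F : ι → ℂ → ℂ} {f : ℂ → ℂ} {U : Set ℂ} (hU : IsOpen U)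
    (hF : ∀ i, Differentiable ℂ (F i)) (h : TendstoLocallyUniformlyOn F f p U) (n : ℕ) :
    TendstoLocallyUniformlyOn (fun i => iteratedDeriv n (F i)) (iteratedDeriv n f) p U := by
  induction n with
  | zero => simpa only [iteratedDeriv_zero] using h
  | succ n ih =>
    have hd : ∀ᶠ i in p, DifferentiableOn ℂ (iteratedDeriv n (F i)) U :=
      Eventually.of_forall fun i =>
        ((hF i).contDiff.differentiable_iteratedDeriv' n).differentiableOn
    have key := ih.deriv hd hU
    simp_rw [iteratedDeriv_succ]
    exact key

/-! ## Membership in the exponential-moment class -/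

/-- A scalar multiple `c · u` of a ground state has all exponential moments finite (`u` is
integrable on the compact window and vanishes a.e. off it). [folklore] -/
theorem momentsOfStrip_expMoment_groundState {a : ℝ} {u : ℝ → ℂ} (hu : IsWeilGroundState a u)
    (c : ℂ) (A : ℝ) :
    Integrable (fun t : ℝ => ‖c * u t‖ * Real.exp (A * |t|)) := by
  have h := (hu.integrable_mul_continuous
    (w := fun t : ℝ => c * ((Real.exp (A * |t|) : ℝ) : ℂ)) (by fun_prop)).norm
  refine h.congr (ae_of_all _ fun t => ?_)
  simp only [norm_mul, Complex.norm_real, Real.norm_eq_abs, Real.abs_exp]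
  ring

/-- Riemann's kernel `Φ(t) = 2Ψ(2t)` has all exponential moments finite (`stub_psiDecay`).
[folklore] -/
theorem momentsOfStrip_expMoment_phi (A : ℝ) :
    Integrable (fun t : ℝ =>
      ‖(2 : ℂ) * LagariasMontague.Psic (2 * t)‖ * Real.exp (A * |t|)) := by
  refine (((stub_psiDecay.2 A).norm).const_mul 2).congr (ae_of_all _ fun t => ?_)
  dsimp only
  rw [norm_phi]
  simp only [norm_mul, Real.norm_eq_abs, Real.abs_exp]
  ring

/-! ## The stub -/

/-- **Stub `stub_moments_of_strip` (RH-free; line exactness).**  For ground states `u_k` and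
scalars `c_k`, the crux's convergence clause (`c_k · weilMellin u_k → ξ` locally uniformly on the
open strip `{0 < Re s < 1}`) forces convergence of ALL moments: `c_k ∫ u_k tⁿ → ∫ Φ tⁿ`,
`Φ(t) = 2Ψ(2t)`.  Holomorphic functions converging locally uniformly on the open strip have all
derivatives converging at `s = 1/2` (`TendstoLocallyUniformlyOn.deriv`, iterated); the `n`-th
derivative of `weilMellin v` at `1/2` is `∫ v tⁿ` for `v = c_k u_k` and for `v = Φ`
(differentiation under the integral sign, `momentsOfStrip_iteratedDeriv`), and
`weilMellin Φ = ξ` (`stub_mellinXi`). [folklore] -/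
theorem stub_moments_of_strip
    {a : ℕ → ℝ} {u : ℕ → ℝ → ℂ} {c : ℕ → ℂ}
    (hu : ∀ k, IsWeilGroundState (a k) (u k))
    (hlim : TendstoLocallyUniformlyOn (fun k s => c k * weilMellin (u k) s) riemannXi atTop
      {s : ℂ | 0 < s.re ∧ s.re < 1}) :
    ∀ n : ℕ, Tendsto (fun k => c k * ∫ t, u k t * (t : ℂ) ^ n) atTop
      (𝓝 (∫ t, 2 * LagariasMontague.Psic (2 * t) * (t : ℂ) ^ n)) := by
  intro n
  have hU : IsOpen {s : ℂ | 0 < s.re ∧ s.re < 1} :=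
    (isOpen_lt continuous_const Complex.continuous_re).inter
      (isOpen_lt Complex.continuous_re continuous_const)
  have hhalf : (1 / 2 : ℂ) ∈ {s : ℂ | 0 < s.re ∧ s.re < 1} := by
    simp only [Set.mem_setOf_eq]
    norm_num
  have hdiff : ∀ k, Differentiable ℂ (fun s => c k * weilMellin (u k) s) := fun k =>
    (hu k).differentiable_weilMellin.const_mul (c k)
  have hpt := (momentsOfStrip_tendstoLocallyUniformlyOn_iteratedDeriv hU hdiff hlim n).tendsto_at
    hhalf
  have e1 : ∀ k, iteratedDeriv n (fun s => c k * weilMellin (u k) s) (1 / 2) =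
      c k * ∫ t, u k t * (t : ℂ) ^ n := by
    intro k
    have hF : (fun s => c k * weilMellin (u k) s) = weilMellin (fun t => c k * u k t) := by
      funext s
      simp only [weilMellin, ← integral_const_mul]
      congr 1
      funext t
      ring
    have hv : AEStronglyMeasurable (fun t => c k * u k t) volume :=
      (hu k).memLp.1.const_mul (c k)
    rw [hF, momentsOfStrip_iteratedDeriv n hv (momentsOfStrip_expMoment_groundState (hu k) (c k)),
      momentsOfStrip_weilMellin_half, ← integral_const_mul]
    congr 1
    funext t
    ring
  have e2 : iteratedDeriv n riemannXi (1 / 2) =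
      ∫ t, 2 * LagariasMontague.Psic (2 * t) * (t : ℂ) ^ n := by
    have hxi : riemannXi = weilMellin (fun t : ℝ => 2 * LagariasMontague.Psic (2 * t)) :=
      (funext (stub_mellinXi stub_psiDecay.1 stub_psiDecay.2)).symm
    rw [hxi, momentsOfStrip_iteratedDeriv n continuous_phi.aestronglyMeasurable
      momentsOfStrip_expMoment_phi, momentsOfStrip_weilMellin_half]
  rw [e2] at hpt
  exact hpt.congr e1

end Summit.RiemannHypothesis.RiemannHypothesis.Theorems.GroundStatesConvergeToXi

end
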